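import Literature.NumberTheory.EllipticCurves.ComplexTorus
import Literature.NumberTheory.EllipticCurves.WeierstrassSchemePoints
import Literature.NumberTheory.EllipticCurves.WeierstrassCurveCharts
import Literature.AlgebraicGeometry.Motives.AlgPointsHolomorphicFamilies
import HarnessLib

/-!
# The uniformisation `ℂ → E_Λ(ℂ)`, `z ↦ [℘(z), ℘'(z)/2, 1]`, is holomorphic

Silverman, *The Arithmetic of Elliptic Curves*, Prop. VI.3.6 (b): for a lattice `Λ ⊂ ℂ` the map
`φ : ℂ/Λ → E_Λ(ℂ) ⊂ ℙ²(ℂ)`, `z ↦ [℘(z), ℘'(z), 1]`, is a complex analytic isomorphism. The tree's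
`Literature/NumberTheory/EllipticCurves/ComplexTorus.lean` has the map on Mathlib points
(`PeriodPair.toPoint`, with `E_Λ : y² = x³ − (g₂/4)x − g₃/4`, `y = ℘'/2`) and its bijectivity
modulo `Λ`; `WeierstrassScheme` / `WeierstrassSchemePoints` have `E_Λ` as a smooth projective
`ℂ`-scheme `E = L.curve.scheme` with `E(ℂ) = E_Λ(ℂ)` (`pointEquiv`). This file proves the
ANALYTIC half of VI.3.6 (b) in the form consumed by the analytification predicate
`Literature.NumberTheory.Transcendental.IsAnalytification` (Serre, GAGA §2): the composite
`PeriodPair.upoint L : ℂ → E(ℂ)` (complex points of the scheme, strong topology) is, locally on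
`ℂ`, a HOLOMORPHIC FAMILY (`AlgPoints.IsHolFamilyOn`,
`Motives/AlgPointsHolomorphicFamilies`): it is interpolated on a disc around every `z₀` by a
`ℂ`-morphism `Spec (holomorphic functions on the disc) → E`. Consequences: `upoint` is continuous
and every regular function on every open of `E` pulls back along `upoint` to a holomorphic
function (`AlgPoints.IsHolFamilyOn.differentiableOn_evalOrZero`).

* `WeierstrassCurve.HolCoordsOn W U g` — a map `g : P → E_W(ℂ)` (`P` a complex normed space) has
  **holomorphic homogeneous coordinates** on `U`: functions `v₀, v₁, v₂` holomorphic on `U`, one of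
  them identically `1`, with `g(x) = [v₀(x), v₁(x), v₂(x)]`; `HolCoordsOn.isHolFamilyOn`: such a `g`
  is a holomorphic family on `U` (the vector `v ∈ (holFun U)³` is a `holFun U`-valued point of the
  chart `D₊(xᵢ)` of `E_W`, `Motives/HypersurfaceCharts.liftVec`, specialising to the `g(x)`).
* `PeriodPair.upoint`, `upoint_eq_upoint_iff` (`upoint z = upoint w ↔ z − w ∈ Λ`),
  `upoint_surjective`, `upoint_add_of_mem` — transported from `ComplexTorus.lean`.
* **Local coordinates** (Silverman VI.3.6 (b), proof: "`φ` is given locally by holomorphic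
  functions"): off `Λ`, `[℘(z), ℘'(z)/2, 1]` (`holCoordsOn_upoint_of_notMem`); at `z₀ ∈ Λ`, in the
  chart `Y ≠ 0` with coordinates `(x/y, z/y)`, `[2℘/℘', 1, 2/℘']` extended holomorphically over
  `z₀` by `[0, 1, 0] = O` — written with Mathlib's regular parts `℘[L - z₀]`, `℘'[L - z₀]`
  (`℘ = ℘[L - z₀] + (z − z₀)⁻² − z₀⁻²`, `℘' = ℘'[L - z₀] − 2(z − z₀)⁻³`) as
  `2w(A'w² + 1)/(Bw³ − 2)`, `2w³/(Bw³ − 2)`, `w = z − z₀` (`holCoordsOn_upoint_of_mem`).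
* `exists_isHolFamilyOn_upoint`, `continuous_upoint`.

Everything is proved; no named facts. The group-theoretic half of VI.3.6 (b) (additivity) is the
tree's `PeriodPair.toPoint_add` and is not used here.

## References

* J. H. Silverman, *The Arithmetic of Elliptic Curves*, 2nd ed., GTM 106 (2009), Prop. VI.3.6 (b),
  IV.1 (the chart at `O`). [SilvermanAEC2009]
* J.-P. Serre, *Géométrie algébrique et géométrie analytique* (1956), §2 n°5. [SerreGAGA1956]

## Design

As in the sibling preludes of this directory (`ComplexTorus`, `WeierstrassSchemePoints`,
`WeierstrassCurveCharts`), the declarations taking a Weierstrass curve `W` resp. a period pair `L`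
are deliberate dot-notation extensions in Mathlib's `namespace WeierstrassCurve` resp.
`namespace PeriodPair` (`W.HolCoordsOn`, `L.upoint`, …). The identification
`(L.curve.baseChange ℂ).toAffine.Point = L.curve.toAffine.Point` needed to feed `L.toPoint z` to
`WeierstrassCurve.pointEquiv` holds by `rfl` (`curve_baseChange`) and is used silently. The chart
at `O` is written in the coordinates `(x/y, z/y)` of the tree's chart `inf` (`WeierstrassSchemeCharts`),
i.e. Silverman's `(z, w) = (−x/y, −1/y)` up to sign.
-/

noncomputable section

open CategoryTheory AlgebraicGeometry MvPolynomial Complex Metric Set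
open Literature.AlgebraicGeometry.Motives Literature.AlgebraicGeometry.Motives.AlgPoints
open Literature.NumberTheory.EllipticCurves
open scoped Topology

/-! ### Holomorphic homogeneous coordinates on a Weierstrass cubic -/

namespace WeierstrassCurve

variable (W : WeierstrassCurve ℂ) {P : Type} [NormedAddCommGroup P] [NormedSpace ℂ P]

/-- **Holomorphic homogeneous coordinates.** A map `g : P → E_W(ℂ)` from a complex normed space
into the complex points of the Weierstrass cubic `E_W ⊂ ℙ²_ℂ` has holomorphic homogeneous
coordinates on `U ⊆ P` if there are functions `v₀, v₁, v₂ : P → ℂ`, complex differentiable on `U`,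
one of which is identically `1`, such that `g(x)` is the point `[v₀(x), v₁(x), v₂(x)]` for every
`x ∈ U` (deliberate dot-notation extension of Mathlib's `WeierstrassCurve`, as the sibling
preludes). Silverman, *AEC*, proof of VI.3.6 (b) ("locally given by holomorphic functions").
[cite: SilvermanAEC2009, Prop. VI.3.6 (b)] -/
def HolCoordsOn (U : Set P) (g : P → AlgPoints W.scheme ℂ) : Prop :=
  ∃ (i : Fin 3) (v : Fin 3 → P → ℂ), (∀ j, DifferentiableOn ℂ (v j) U) ∧ (∀ x, v i x = 1) ∧
    ∀ x ∈ U, ∃ (hv : (fun j ↦ v j x) ≠ 0) (hF : (W.baseChange ℂ).toProjective.Equation fun j ↦ v j x),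
      g x = W.schemePoint (fun j ↦ v j x) hv hF

variable {W}

/-- Holomorphic homogeneous coordinates restrict to smaller sets. [folklore] -/
theorem HolCoordsOn.mono {U U' : Set P} {g : P → AlgPoints W.scheme ℂ} (h : W.HolCoordsOn U g)
    (hU' : U' ⊆ U) : W.HolCoordsOn U' g := by
  obtain ⟨i, v, hv, hi, hg⟩ := h
  exact ⟨i, v, fun j ↦ (hv j).mono hU', hi, fun x hx ↦ hg x (hU' hx)⟩

/-- **A map with holomorphic homogeneous coordinates on `U` is a holomorphic family on `U`**: the
coordinate vector `v ∈ (holFun U)³` has a unit coordinate and solves the Weierstrass cubic in the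
reduced ring `holFun U`, hence defines a `holFun U`-valued point of the chart `D₊(xᵢ) ∩ E_W`
(`SmoothHypersurface.liftVec`), whose specialisation at `x ∈ U` is `[v(x)] = g(x)`
(`specOverOfAlgHom_liftVec_chart_schemeι`, functoriality of `vecChartPoint`, and injectivity of
`E_W(ℂ) → ℙ²(ℂ)`). [cite: SerreGAGA1956, §2 n°5] -/
theorem HolCoordsOn.isHolFamilyOn {U : Set P} {g : P → AlgPoints W.scheme ℂ}
    (h : W.HolCoordsOn U g) : IsHolFamilyOn U g := by
  obtain ⟨i, v, hv, hi, hg⟩ := h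
  -- the coordinate vector with values in the ring of holomorphic functions on `U`
  let vR : Fin 3 → holFun U := fun j ↦ holFun.restrict (v j) (hv j)
  have hvRi : vR i = 1 := Subtype.ext (funext fun x ↦ hi x)
  have hunit : IsUnit (aeval vR (X i : MvPolynomial (Fin 3) ℂ)) := by
    rw [aeval_X, hvRi]
    exact isUnit_one
  have heval : ∀ (x : U) (p : MvPolynomial (Fin 3) ℂ),
      holEvalₐ x (aeval vR p) = aeval (fun j ↦ v j x) p := fun x p ↦ by
    change ((holEvalₐ x).comp (aeval vR)) p = _
    rw [MvPolynomial.comp_aeval]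
    rfl
  have hF : aeval vR W.toProjective.polynomial = 0 := by
    refine Subtype.ext (funext fun x ↦ ?_)
    obtain ⟨-, hFx, -⟩ := hg x x.2
    change holEvalₐ x (aeval vR W.toProjective.polynomial) = 0
    rw [heval, W.aeval_toProjective_polynomial_eq_zero_iff]
    exact hFx
  refine ⟨specOverOfAlgHom (SmoothHypersurface.liftVec (n := 1) W.toProjective.polynomial i
      W.toProjective.isHomogeneous_polynomial vR hunit hF) ≫ W.chart i, fun x ↦ ?_⟩
  obtain ⟨hv0, hFx, hgx⟩ := hg x x.2
  have hunitx : IsUnit (aeval (fun j ↦ holEvalₐ x (vR j)) (X i : MvPolynomial (Fin 3) ℂ)) := by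
    rw [aeval_X]
    change IsUnit (v i x)
    rw [hi]
    exact isUnit_one
  apply AlgPoints.map_injective_of_mono W.schemeι
  rw [hgx, W.map_schemeι_schemePoint, AlgPoints.map_apply]
  simp only [Category.assoc]
  rw [W.specOverOfAlgHom_liftVec_chart_schemeι i vR hunit hF,
    ProjectiveSpace.specOverOfAlgHom_comp_vecChartPoint (holEvalₐ x) _ _ vR hunit hunitx,
    ProjectiveSpace.pointOfVec_eq_chartPoint _ hv0 (ProjectiveSpace.X_mem i) one_pos
      (hunitx.ne_zero)]
  rfl

end WeierstrassCurve

/-! ### The uniformisation map into the complex points of the scheme `E_Λ` -/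

namespace PeriodPair

variable (L : PeriodPair)

/-- Over `ℂ` the base change `E_Λ ×_ℂ ℂ` of Mathlib's Weierstrass curve is `E_Λ` itself (`rfl`;
used silently to identify `E_Λ(ℂ)`-points of both). [folklore] -/
theorem curve_baseChange : L.curve.baseChange ℂ = L.curve := rfl

/-- **The uniformisation `ℂ → E_Λ(ℂ)`** with values in the complex points (strong topology) of
the smooth projective `ℂ`-scheme `E_Λ = L.curve.scheme`: `z ↦ [℘(z), ℘'(z)/2, 1]` off `Λ` and
`z ↦ O = [0, 1, 0]` on `Λ`; the tree's `PeriodPair.toPoint` followed by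
`WeierstrassCurve.pointEquiv` (deliberate dot-notation extension of Mathlib's `PeriodPair`, as the
sibling preludes). Silverman, *AEC*, Prop. VI.3.6 (b). [cite: SilvermanAEC2009, Prop. VI.3.6 (b)] -/
def upoint (z : ℂ) : AlgPoints L.curve.scheme ℂ :=
  L.curve.pointEquiv (L.toPoint z)

variable {L}

/-- On the lattice, `upoint` is `O = [0, 1, 0]`. [cite: SilvermanAEC2009, Prop. VI.3.6 (b)] -/
theorem upoint_of_mem {z : ℂ} (hz : z ∈ L.lattice) :
    L.upoint z = L.curve.schemePoint ![0, 1, 0] fin3_zero_one_zero_ne_zero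
      WeierstrassCurve.Projective.equation_zero := by
  rw [upoint, toPoint_of_mem hz]
  exact L.curve.pointEquiv_zero

/-- Off the lattice, `upoint z = [℘(z), ℘'(z)/2, 1]`. [cite: SilvermanAEC2009, Prop. VI.3.6 (b)] -/
theorem upoint_of_notMem {z : ℂ} (hz : z ∉ L.lattice) :
    ∃ hF, L.upoint z = L.curve.schemePoint ![℘[L] z, ℘'[L] z / 2, 1] (fin3_one_ne_zero _ _) hF := by
  rw [upoint, toPoint_of_notMem hz]
  exact ⟨_, L.curve.pointEquiv_some _⟩

/-- **Injectivity modulo `Λ`**: `upoint z = upoint w ↔ z − w ∈ Λ` (the tree's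
`toPoint_eq_toPoint_iff`). [cite: SilvermanAEC2009, Prop. VI.3.6 (b)] -/
theorem upoint_eq_upoint_iff {z w : ℂ} : L.upoint z = L.upoint w ↔ z - w ∈ L.lattice :=
  (L.curve.pointEquiv).apply_eq_iff_eq.trans (toPoint_eq_toPoint_iff L)

/-- `upoint` is `Λ`-periodic. [cite: SilvermanAEC2009, Prop. VI.3.6 (b)] -/
theorem upoint_add_of_mem (z : ℂ) {l : ℂ} (hl : l ∈ L.lattice) : L.upoint (z + l) = L.upoint z :=
  upoint_eq_upoint_iff.mpr (by simpa using hl)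

variable (L) in
/-- **Surjectivity**: every complex point of `E_Λ` is a `upoint z` (the tree's
`toPoint_surjective`). [cite: SilvermanAEC2009, Prop. VI.3.6 (b)] -/
theorem upoint_surjective : Function.Surjective L.upoint :=
  (L.curve.pointEquiv).surjective.comp (toPoint_surjective L)

/-! ### Local holomorphic coordinates off the lattice -/

/-- The coordinate functions `[℘, ℘'/2, 1]`. [cite: SilvermanAEC2009, Prop. VI.3.6 (b)] -/
def affCoords (L : PeriodPair) : Fin 3 → ℂ → ℂ := fun j z ↦ ![℘[L] z, ℘'[L] z / 2, 1] j

/-- **Off `Λ`, `upoint` has the holomorphic homogeneous coordinates `[℘, ℘'/2, 1]`** on a disc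
around `z₀ ∉ Λ` missing `Λ`. [cite: SilvermanAEC2009, Prop. VI.3.6 (b)] -/
theorem holCoordsOn_upoint_of_notMem {z₀ : ℂ} (hz₀ : z₀ ∉ L.lattice) :
    ∃ ε > 0, L.curve.HolCoordsOn (ball z₀ ε) L.upoint := by
  obtain ⟨ε, hε, hball⟩ := Metric.isOpen_iff.mp L.isClosed_lattice.isOpen_compl z₀ hz₀
  refine ⟨ε, hε, 2, affCoords L, fun j ↦ ?_, fun _ ↦ rfl, fun z hz ↦ ?_⟩
  · have h℘ : DifferentiableOn ℂ ℘[L] (ball z₀ ε) := L.differentiableOn_weierstrassP.mono hball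
    have h℘' : DifferentiableOn ℂ ℘'[L] (ball z₀ ε) := L.differentiableOn_derivWeierstrassP.mono hball
    fin_cases j
    · exact h℘
    · exact h℘'.div_const 2
    · exact differentiableOn_const (1 : ℂ)
  · obtain ⟨hF, h⟩ := upoint_of_notMem (hball hz)
    exact ⟨fin3_one_ne_zero _ _, hF, h⟩

/-! ### Local holomorphic coordinates at a lattice point -/

section AtLattice

variable (L) (z₀ : ℂ)

/-- The denominator `D(z) = ℘'[L - z₀](z) (z − z₀)³ − 2`, so that `℘' = D / (z − z₀)³` near `z₀`;
`D(z₀) = −2`. [cite: SilvermanAEC2009, IV.1] -/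
def infDen (z : ℂ) : ℂ := ℘'[L - z₀] z * (z - z₀) ^ 3 - 2

/-- The first coordinate `x/y = 2℘/℘'` of `upoint` in the chart `Y ≠ 0`, continued over `z₀`:
`2 (z − z₀) ((℘[L - z₀](z) − z₀⁻²)(z − z₀)² + 1) / D(z)`. [cite: SilvermanAEC2009, IV.1] -/
def infU (z : ℂ) : ℂ :=
  2 * (z - z₀) * ((℘[L - z₀] z - 1 / z₀ ^ 2) * (z - z₀) ^ 2 + 1) / L.infDen z₀ z

/-- The last coordinate `1/y = 2/℘'` of `upoint` in the chart `Y ≠ 0`, continued over `z₀`: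
`2 (z − z₀)³ / D(z)`. [cite: SilvermanAEC2009, IV.1] -/
def infV (z : ℂ) : ℂ := 2 * (z - z₀) ^ 3 / L.infDen z₀ z

/-- The coordinate functions `[2℘/℘', 1, 2/℘']` continued over `z₀`.
[cite: SilvermanAEC2009, Prop. VI.3.6 (b)] -/
def infCoords : Fin 3 → ℂ → ℂ := fun j z ↦ ![L.infU z₀ z, 1, L.infV z₀ z] j

variable {z₀}

/-- `D` is holomorphic on `(Λ ∖ {z₀})ᶜ`. [folklore] -/
theorem differentiableOn_infDen : DifferentiableOn ℂ (L.infDen z₀) (L.lattice \ {z₀})ᶜ :=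
  ((L.analyticOnNhd_derivWeierstrassPExcept z₀).differentiableOn.mul
    ((differentiableOn_id.sub (differentiableOn_const _)).pow 3)).sub (differentiableOn_const _)

/-- `D(z₀) = −2`. [folklore] -/
theorem infDen_self : L.infDen z₀ z₀ = -2 := by simp [infDen]

/-- A disc around `z₀` missing `Λ ∖ {z₀}` on which `D ≠ 0`. [folklore] -/
theorem exists_ball_infDen_ne_zero :
    ∃ ε > 0, ball z₀ ε ⊆ (L.lattice \ {z₀})ᶜ ∧ ∀ z ∈ ball z₀ ε, L.infDen z₀ z ≠ 0 := by
  have hO : IsOpen ((L.lattice : Set ℂ) \ {z₀})ᶜ := L.isOpen_compl_lattice_sdiff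
  have hz₀ : z₀ ∈ ((L.lattice : Set ℂ) \ {z₀})ᶜ := fun h ↦ h.2 rfl
  have hopen : IsOpen (((L.lattice : Set ℂ) \ {z₀})ᶜ ∩ L.infDen z₀ ⁻¹' {0}ᶜ) :=
    L.differentiableOn_infDen.continuousOn.isOpen_inter_preimage hO isOpen_compl_singleton
  have hmem : z₀ ∈ ((L.lattice : Set ℂ) \ {z₀})ᶜ ∩ L.infDen z₀ ⁻¹' {0}ᶜ :=
    ⟨hz₀, by rw [mem_preimage, infDen_self]; norm_num⟩
  obtain ⟨ε, hε, hball⟩ := Metric.isOpen_iff.mp hopen z₀ hmem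
  exact ⟨ε, hε, fun z hz ↦ (hball hz).1, fun z hz ↦ (hball hz).2⟩

/-- `2℘/℘'` and `2/℘'`, continued, are holomorphic where `D ≠ 0`. [folklore] -/
theorem differentiableOn_infCoords {s : Set ℂ} (hs : s ⊆ (L.lattice \ {z₀})ᶜ)
    (hD : ∀ z ∈ s, L.infDen z₀ z ≠ 0) (j : Fin 3) : DifferentiableOn ℂ (L.infCoords z₀ j) s := by
  have hw : DifferentiableOn ℂ (fun z : ℂ ↦ z - z₀) s := differentiableOn_id.sub (differentiableOn_const _)
  have hDd : DifferentiableOn ℂ (L.infDen z₀) s := L.differentiableOn_infDen.mono hs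
  have hA : DifferentiableOn ℂ ℘[L - z₀] s := (L.analyticOnNhd_weierstrassPExcept z₀).differentiableOn.mono hs
  fin_cases j
  · change DifferentiableOn ℂ (L.infU z₀) s
    exact (((differentiableOn_const _).mul hw).mul
      (((hA.sub (differentiableOn_const _)).mul (hw.pow 2)).add (differentiableOn_const _))).div hDd hD
  · exact differentiableOn_const (1 : ℂ)
  · change DifferentiableOn ℂ (L.infV z₀) s
    exact ((differentiableOn_const _).mul (hw.pow 3)).div hDd hD

/-- At `z₀` the continued coordinates are `[0, 1, 0]`. [folklore] -/
theorem infCoords_self : (fun j ↦ L.infCoords z₀ j z₀) = ![0, 1, 0] := by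
  ext j
  fin_cases j <;> simp [infCoords, infU, infV]

/-- **Off `z₀`, the continued coordinates are `(2/℘') • [℘, ℘'/2, 1]`**: for `z₀ ∈ Λ`, `z ∉ Λ`
with `D(z) ≠ 0` one has `℘'(z) = D(z)/(z − z₀)³ ≠ 0` and
`[infU z, 1, infV z] = (2/℘'(z)) • [℘(z), ℘'(z)/2, 1]` (from `℘ = ℘[L - z₀] + (z − z₀)⁻² − z₀⁻²`,
`℘' = ℘'[L - z₀] − 2(z − z₀)⁻³`). [cite: SilvermanAEC2009, IV.1] -/
theorem infCoords_eq_smul (hz₀ : z₀ ∈ L.lattice) {z : ℂ} (hz : z ∉ L.lattice)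
    (hD : L.infDen z₀ z ≠ 0) :
    ℘'[L] z ≠ 0 ∧ (fun j ↦ L.infCoords z₀ j z) = (2 / ℘'[L] z) • ![℘[L] z, ℘'[L] z / 2, 1] := by
  have hw : z - z₀ ≠ 0 := by
    intro h
    exact hz ((sub_eq_zero.mp h) ▸ hz₀)
  have h℘ : ℘[L] z = ℘[L - z₀] z + (1 / (z - z₀) ^ 2 - 1 / z₀ ^ 2) :=
    (L.weierstrassPExcept_add ⟨z₀, hz₀⟩ z).symm
  have h℘' : ℘'[L] z = L.infDen z₀ z / (z - z₀) ^ 3 := by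
    rw [← L.derivWeierstrassPExcept_sub ⟨z₀, hz₀⟩ z, infDen]
    field_simp
  have h℘'0 : ℘'[L] z ≠ 0 := by
    rw [h℘']
    exact div_ne_zero hD (pow_ne_zero 3 hw)
  refine ⟨h℘'0, ?_⟩
  set c : ℂ := 1 / z₀ ^ 2 with hc
  ext j
  fin_cases j
  · simp only [infCoords, infU, Fin.zero_eta, Fin.isValue, Matrix.cons_val_zero, Pi.smul_apply,
      smul_eq_mul]
    rw [h℘, h℘']
    field_simp
    ring
  · simp only [infCoords, Fin.mk_one, Fin.isValue, Matrix.cons_val_one, Matrix.cons_val_zero,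
      Pi.smul_apply, smul_eq_mul]
    field_simp
  · simp only [infCoords, infV, Fin.reduceFinMk, Fin.isValue, Matrix.cons_val, Pi.smul_apply,
      smul_eq_mul, mul_one]
    rw [h℘']
    field_simp

/-- **At a lattice point, `upoint` has the holomorphic homogeneous coordinates
`[2℘/℘', 1, 2/℘']` continued by `[0, 1, 0]`** (the chart `Y ≠ 0` of `E_Λ ⊂ ℙ²` at `O`).
[cite: SilvermanAEC2009, Prop. VI.3.6 (b)] -/
theorem holCoordsOn_upoint_of_mem (hz₀ : z₀ ∈ L.lattice) :
    ∃ ε > 0, L.curve.HolCoordsOn (ball z₀ ε) L.upoint := by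
  obtain ⟨ε, hε, hball, hD⟩ := L.exists_ball_infDen_ne_zero (z₀ := z₀)
  refine ⟨ε, hε, 1, L.infCoords z₀, L.differentiableOn_infCoords hball hD, fun _ ↦ rfl,
    fun z hz ↦ ?_⟩
  by_cases hzz : z = z₀
  · subst hzz
    rw [infCoords_self]
    exact ⟨fin3_zero_one_zero_ne_zero, WeierstrassCurve.Projective.equation_zero, upoint_of_mem hz₀⟩
  · have hzΛ : z ∉ L.lattice := fun h ↦ hball hz ⟨h, hzz⟩
    obtain ⟨h℘'0, heq⟩ := L.infCoords_eq_smul hz₀ hzΛ (hD z hz)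
    obtain ⟨hF, hup⟩ := upoint_of_notMem hzΛ
    have hc : (2 / ℘'[L] z) ≠ 0 := div_ne_zero two_ne_zero h℘'0
    have hv : (2 / ℘'[L] z) • ![℘[L] z, ℘'[L] z / 2, 1] ≠ 0 :=
      smul_ne_zero hc (fin3_one_ne_zero _ _)
    have hF' : (L.curve.baseChange ℂ).toProjective.Equation
        ((2 / ℘'[L] z) • ![℘[L] z, ℘'[L] z / 2, 1]) :=
      (WeierstrassCurve.Projective.equation_smul _ hc.isUnit).mpr hF
    rw [heq]
    exact ⟨hv, hF', hup.trans (L.curve.schemePoint_eq_of_equiv ⟨Units.mk0 _ hc, rfl⟩ _ _ _ _).symm⟩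

end AtLattice

/-! ### Consequences: `upoint` is a holomorphic family, locally; continuity -/

variable (L)

/-- **`upoint` has holomorphic homogeneous coordinates near every point of `ℂ`.**
[cite: SilvermanAEC2009, Prop. VI.3.6 (b)] -/
theorem exists_holCoordsOn_upoint (z₀ : ℂ) : ∃ ε > 0, L.curve.HolCoordsOn (ball z₀ ε) L.upoint := by
  by_cases hz₀ : z₀ ∈ L.lattice
  · exact L.holCoordsOn_upoint_of_mem hz₀
  · exact holCoordsOn_upoint_of_notMem hz₀

/-- **`upoint : ℂ → E_Λ(ℂ)` is a holomorphic family near every point** (interpolated on a disc by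
a morphism `Spec (holomorphic functions) → E_Λ`). Silverman VI.3.6 (b); Serre, GAGA §2 n°5.
[cite: SilvermanAEC2009, Prop. VI.3.6 (b)] -/
theorem exists_isHolFamilyOn_upoint (z₀ : ℂ) : ∃ ε > 0, IsHolFamilyOn (ball z₀ ε) L.upoint := by
  obtain ⟨ε, hε, h⟩ := L.exists_holCoordsOn_upoint z₀
  exact ⟨ε, hε, h.isHolFamilyOn⟩

/-- **`upoint : ℂ → E_Λ(ℂ)` is continuous** for the strong (analytic) topology on `E_Λ(ℂ)`.
[cite: SilvermanAEC2009, Prop. VI.3.6 (b)] -/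
theorem continuous_upoint : Continuous L.upoint := by
  refine continuous_iff_continuousAt.mpr fun z₀ ↦ ?_
  obtain ⟨ε, hε, h⟩ := L.exists_isHolFamilyOn_upoint z₀
  exact (h.continuousOn isOpen_ball).continuousAt (ball_mem_nhds z₀ hε)

/-- **Regular functions on `E_Λ` are holomorphic in the uniformising parameter**: for an open
`W ⊆ E_Λ` and `g ∈ Γ(E_Λ, W)`, `z ↦ g(upoint z)` is complex differentiable on the open set
`upoint⁻¹(W(ℂ))`. [cite: SerreGAGA1956, §2 n°5] -/
theorem differentiableOn_evalOrZero_upoint (W : L.curve.scheme.left.Opens)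
    (g : Γ(L.curve.scheme.left, W)) :
    DifferentiableOn ℂ (fun z ↦ evalOrZero W g (L.upoint z)) (L.upoint ⁻¹' {Q | Q.pt ∈ W}) := by
  intro z₀ hz₀
  obtain ⟨ε, hε, h⟩ := L.exists_isHolFamilyOn_upoint z₀
  have hd := h.differentiableOn_evalOrZero isOpen_ball W g
  have hopen := h.isOpen_inter_preimage isOpen_ball W
  exact (hd.differentiableAt (hopen.mem_nhds ⟨mem_ball_self hε, hz₀⟩)).differentiableWithinAt

end PeriodPair
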